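import Summits.ValiantsHypothesis.ValiantsHypothesis.Theorems.KPlusLogSqLawStaticPathWalls

/-!
# Route «KPlusLogSqLaw» — parametric max-weight independent set on a path: the events are at most `8(n+1)` plus the CUT–CUT events

HONEST FRAMING.  Helper toward the crux `WeakLifting` (item `stmt-ValiantsHypothesis-19561`, route `KPlusLogSqLaw`, cell `pub-symmetroid`,
seat val-sym-lift-p4 g21, 2026-08-29) on the line of its witness-plan stub `stub_tridiagonalSectorB` (tropical twin of the STATIC tridiagonal
sector = parametric maximum-weight independent set on a path).  The corollary of `…StaticPathWalls` (ORDER.md Proposition 1, val-sym-lift-p4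
g10): in the event vocabulary of THEOREM T (`…StaticPathMixedEvents.mixedEvents_card_le`: pairs `p < q ≤ n` with (M) every line strictly between
correct at the vertex, (L) an even run of correct lines just left of `p` ended by an incorrect line or by the left end, (R) likewise right of `q`),
every event has a right wall that is VIRTUAL, KILLING or CUTTING (the first incorrect later line `c ≤ n`, with the window of `p` still alive at
step `c`: some parameter has all of `(p, c]` strictly correct against `p`) and likewise a left wall; by `card_rightWall_virtual_or_killing_le` /
`card_leftWall_virtual_or_killing_le` the events with a non-cutting wall on some side are at most `8 (n + 1)`, so
**`card_events_le_cutCut`**: `#events ≤ 8 (n + 1) + #{events whose two walls both CUT}` — the kernel form of ORDER.md's corollary «bp = O(n) iff the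
cut–cut events are O(n)».  (No parity hypothesis on `p + q`: hops and jumps alike.)  Also ORDER.md Lemma 2, the SHAPE of a cutting wall:
**`cut_parity_iff_slope_between`** — along the base line `o`, a partner `q` (gap zero at the vertex) and a wall `c` (strictly incorrect there) that
are simultaneously strictly correct at some parameter (the wall CUTS) have opposite parities iff the slope of `o` lies strictly between those of `q`
and `c`; so a cut–cut EVENT `z < p < q < c` has its four slopes monotone in the order `(z, q, p, c)` (4-point cups/caps for hops, zigzags for
jumps).  Statements about a labelled line arrangement; nothing here asserts anything about `WeakLifting`, `TropicalB`, `KPlusLogSqLaw`, the stub in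
its window, `MatrixDescartes` (stmt-ValiantsHypothesis-18050) or `VP ≠ VNP`; the cut–cut class and the ORDER QUESTION stay open.
-/

set_option linter.dupNamespace false
set_option autoImplicit false

namespace Summit.ValiantsHypothesis.ValiantsHypothesis.Theorems.KPlusLogSqLaw

open Finset Classical

namespace StaticPathFold

noncomputable section

variable (a b : ℕ → ℝ)

/-- **THE EVENTS ARE AT MOST `8(n+1)` PLUS THE CUT–CUT EVENTS** (ORDER.md Proposition 1, corollary).  Lines `0..n` with pairwise distinct slopes;
the pairs `p < q ≤ n` with (M), (L), (R) (the events of THEOREM T's vocabulary, written with the signed `gap` against `L p` at the crossing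
abscissa `τ = (b q - b p) / (a p - a q)`) number at most `8 (n + 1)` plus the number of those among them whose right wall `c = q + r + 1 ≤ n` CUTS
(some parameter has every line of `(p, c]` strictly correct against `p`) AND whose left wall `z = p - r' - 1 ≥ 0` CUTS (some parameter has every
line of `[z, q)` strictly correct against `q`). [folklore] -/
theorem card_events_le_cutCut (n : ℕ) (hslope : ∀ p q, p ≤ n → q ≤ n → p ≠ q → a p ≠ a q) :
    (((range (n + 1)) ×ˢ (range (n + 1))).filter (fun pq : ℕ × ℕ => pq.1 < pq.2 ∧ pq.2 ≤ n ∧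
        (∀ t, pq.1 < t → t < pq.2 →
          0 < gap t (L a b pq.1 ((b pq.2 - b pq.1) / (a pq.1 - a pq.2))) (L a b t ((b pq.2 - b pq.1) / (a pq.1 - a pq.2)))) ∧
        (∃ r, Even r ∧ r ≤ pq.1 ∧
          (∀ t, pq.1 - r ≤ t → t < pq.1 →
            0 < gap t (L a b pq.1 ((b pq.2 - b pq.1) / (a pq.1 - a pq.2))) (L a b t ((b pq.2 - b pq.1) / (a pq.1 - a pq.2)))) ∧
          (r = pq.1 ∨ ¬ 0 < gap (pq.1 - r - 1) (L a b pq.1 ((b pq.2 - b pq.1) / (a pq.1 - a pq.2)))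
            (L a b (pq.1 - r - 1) ((b pq.2 - b pq.1) / (a pq.1 - a pq.2))))) ∧
        (∃ r, Even r ∧ pq.2 + r ≤ n ∧
          (∀ t, pq.2 < t → t ≤ pq.2 + r →
            0 < gap t (L a b pq.1 ((b pq.2 - b pq.1) / (a pq.1 - a pq.2))) (L a b t ((b pq.2 - b pq.1) / (a pq.1 - a pq.2)))) ∧
          (pq.2 + r = n ∨ ¬ 0 < gap (pq.2 + r + 1) (L a b pq.1 ((b pq.2 - b pq.1) / (a pq.1 - a pq.2)))
            (L a b (pq.2 + r + 1) ((b pq.2 - b pq.1) / (a pq.1 - a pq.2))))))).card ≤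
      8 * (n + 1) +
      (((range (n + 1)) ×ˢ (range (n + 1))).filter (fun pq : ℕ × ℕ => pq.1 < pq.2 ∧ pq.2 ≤ n ∧
        (∀ t, pq.1 < t → t < pq.2 →
          0 < gap t (L a b pq.1 ((b pq.2 - b pq.1) / (a pq.1 - a pq.2))) (L a b t ((b pq.2 - b pq.1) / (a pq.1 - a pq.2)))) ∧
        (∃ r, Even r ∧ r ≤ pq.1 ∧
          (∀ t, pq.1 - r ≤ t → t < pq.1 →
            0 < gap t (L a b pq.1 ((b pq.2 - b pq.1) / (a pq.1 - a pq.2))) (L a b t ((b pq.2 - b pq.1) / (a pq.1 - a pq.2)))) ∧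
          (r = pq.1 ∨ ¬ 0 < gap (pq.1 - r - 1) (L a b pq.1 ((b pq.2 - b pq.1) / (a pq.1 - a pq.2)))
            (L a b (pq.1 - r - 1) ((b pq.2 - b pq.1) / (a pq.1 - a pq.2))))) ∧
        (∃ r, Even r ∧ pq.2 + r ≤ n ∧
          (∀ t, pq.2 < t → t ≤ pq.2 + r →
            0 < gap t (L a b pq.1 ((b pq.2 - b pq.1) / (a pq.1 - a pq.2))) (L a b t ((b pq.2 - b pq.1) / (a pq.1 - a pq.2)))) ∧
          (pq.2 + r = n ∨ ¬ 0 < gap (pq.2 + r + 1) (L a b pq.1 ((b pq.2 - b pq.1) / (a pq.1 - a pq.2)))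
            (L a b (pq.2 + r + 1) ((b pq.2 - b pq.1) / (a pq.1 - a pq.2))))) ∧
        -- the right wall `c = q + r + 1 ≤ n` cuts: the window of `p` is alive at step `c`
        (∃ r, pq.2 + r + 1 ≤ n ∧
          (∀ t, pq.2 < t → t ≤ pq.2 + r →
            0 < gap t (L a b pq.1 ((b pq.2 - b pq.1) / (a pq.1 - a pq.2))) (L a b t ((b pq.2 - b pq.1) / (a pq.1 - a pq.2)))) ∧
          ¬ 0 < gap (pq.2 + r + 1) (L a b pq.1 ((b pq.2 - b pq.1) / (a pq.1 - a pq.2)))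
            (L a b (pq.2 + r + 1) ((b pq.2 - b pq.1) / (a pq.1 - a pq.2))) ∧
          ∃ θ, ∀ t, pq.1 < t → t ≤ pq.2 + r + 1 → 0 < gap t (L a b pq.1 θ) (L a b t θ)) ∧
        -- the left wall `z = p - r' - 1 ≥ 0` cuts: the window of `q` read leftwards is alive at step `z`
        (∃ r, r + 1 ≤ pq.1 ∧
          (∀ t, pq.1 - r ≤ t → t < pq.1 →
            0 < gap t (L a b pq.1 ((b pq.2 - b pq.1) / (a pq.1 - a pq.2))) (L a b t ((b pq.2 - b pq.1) / (a pq.1 - a pq.2)))) ∧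
          ¬ 0 < gap (pq.1 - r - 1) (L a b pq.1 ((b pq.2 - b pq.1) / (a pq.1 - a pq.2)))
            (L a b (pq.1 - r - 1) ((b pq.2 - b pq.1) / (a pq.1 - a pq.2))) ∧
          ∃ θ, ∀ t, pq.1 - r - 1 ≤ t → t < pq.2 → 0 < gap t (L a b pq.2 θ) (L a b t θ)))).card := by
  -- abbreviations for the three classes
  set P : Finset (ℕ × ℕ) := (range (n + 1)) ×ˢ (range (n + 1)) with hP
  set τ : ℕ × ℕ → ℝ := fun pq => (b pq.2 - b pq.1) / (a pq.1 - a pq.2) with hτ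
  set G : ℕ × ℕ → ℕ → Prop := fun pq t => 0 < gap t (L a b pq.1 (τ pq)) (L a b t (τ pq)) with hG
  set Mc : ℕ × ℕ → Prop := fun pq => ∀ t, pq.1 < t → t < pq.2 → G pq t with hMc
  set Lc : ℕ × ℕ → Prop := fun pq => ∃ r, Even r ∧ r ≤ pq.1 ∧ (∀ t, pq.1 - r ≤ t → t < pq.1 → G pq t) ∧
    (r = pq.1 ∨ ¬ G pq (pq.1 - r - 1)) with hLc
  set Rc : ℕ × ℕ → Prop := fun pq => ∃ r, Even r ∧ pq.2 + r ≤ n ∧ (∀ t, pq.2 < t → t ≤ pq.2 + r → G pq t) ∧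
    (pq.2 + r = n ∨ ¬ G pq (pq.2 + r + 1)) with hRc
  set RV : ℕ × ℕ → Prop := fun pq => ∀ t, pq.2 < t → t ≤ n → G pq t with hRV
  set RK : ℕ × ℕ → Prop := fun pq => ∃ c, pq.2 < c ∧ c ≤ n ∧ (∀ t, pq.2 < t → t < c → G pq t) ∧ ¬ G pq c ∧
    (∀ θ, ¬ ∀ t, pq.1 < t → t ≤ c → 0 < gap t (L a b pq.1 θ) (L a b t θ)) with hRK
  set RC : ℕ × ℕ → Prop := fun pq => ∃ r, pq.2 + r + 1 ≤ n ∧ (∀ t, pq.2 < t → t ≤ pq.2 + r → G pq t) ∧ ¬ G pq (pq.2 + r + 1) ∧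
    ∃ θ, ∀ t, pq.1 < t → t ≤ pq.2 + r + 1 → 0 < gap t (L a b pq.1 θ) (L a b t θ) with hRC
  set LV : ℕ × ℕ → Prop := fun pq => ∀ t, t < pq.1 → G pq t with hLV
  set LK : ℕ × ℕ → Prop := fun pq => ∃ z, z < pq.1 ∧ (∀ t, z < t → t < pq.1 → G pq t) ∧ ¬ G pq z ∧
    (∀ θ, ¬ ∀ t, z ≤ t → t < pq.2 → 0 < gap t (L a b pq.2 θ) (L a b t θ)) with hLK
  set LC : ℕ × ℕ → Prop := fun pq => ∃ r, r + 1 ≤ pq.1 ∧ (∀ t, pq.1 - r ≤ t → t < pq.1 → G pq t) ∧ ¬ G pq (pq.1 - r - 1) ∧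
    ∃ θ, ∀ t, pq.1 - r - 1 ≤ t → t < pq.2 → 0 < gap t (L a b pq.2 θ) (L a b t θ) with hLC
  -- the statement in these terms
  show (P.filter (fun pq => pq.1 < pq.2 ∧ pq.2 ≤ n ∧ Mc pq ∧ Lc pq ∧ Rc pq)).card ≤
      8 * (n + 1) + (P.filter (fun pq => pq.1 < pq.2 ∧ pq.2 ≤ n ∧ Mc pq ∧ Lc pq ∧ Rc pq ∧ RC pq ∧ LC pq)).card
  have hR := card_rightWall_virtual_or_killing_le a b n hslope
  have hL := card_leftWall_virtual_or_killing_le a b n hslope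
  change (P.filter (fun pq => pq.1 < pq.2 ∧ pq.2 ≤ n ∧ Mc pq ∧ (RV pq ∨ RK pq))).card ≤ 4 * (n + 1) at hR
  change (P.filter (fun pq => pq.1 < pq.2 ∧ pq.2 ≤ n ∧ Mc pq ∧ (LV pq ∨ LK pq))).card ≤ 4 * (n + 1) at hL
  -- trichotomy of walls: (R) gives a virtual, killing or cutting right wall; (L) likewise on the left
  have hRtri : ∀ pq, Rc pq → RV pq ∨ RK pq ∨ RC pq := by
    rintro pq ⟨r, -, hrn, hrun, hend⟩
    by_cases hv : pq.2 + r = n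
    · left; intro t h1 h2; exact hrun t h1 (by omega)
    · have hcn : pq.2 + r + 1 ≤ n := by omega
      have hbad : ¬ G pq (pq.2 + r + 1) := hend.resolve_left hv
      right
      by_cases halive : ∃ θ, ∀ t, pq.1 < t → t ≤ pq.2 + r + 1 → 0 < gap t (L a b pq.1 θ) (L a b t θ)
      · right; exact ⟨r, hcn, hrun, hbad, halive⟩
      · left
        push Not at halive
        refine ⟨pq.2 + r + 1, by omega, hcn, fun t h1 h2 => hrun t h1 (by omega), hbad, fun θ hall => ?_⟩
        obtain ⟨t, h1, h2, h3⟩ := halive θ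
        exact absurd (hall t h1 h2) (not_lt.mpr h3)
  have hLtri : ∀ pq, Lc pq → LV pq ∨ LK pq ∨ LC pq := by
    rintro pq ⟨r, -, hrp, hrun, hend⟩
    by_cases hv : r = pq.1
    · left; intro t ht; exact hrun t (by omega) ht
    · have hz : r + 1 ≤ pq.1 := by omega
      have hbad : ¬ G pq (pq.1 - r - 1) := hend.resolve_left hv
      right
      by_cases halive : ∃ θ, ∀ t, pq.1 - r - 1 ≤ t → t < pq.2 → 0 < gap t (L a b pq.2 θ) (L a b t θ)
      · right; exact ⟨r, hz, hrun, hbad, halive⟩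
      · left
        push Not at halive
        refine ⟨pq.1 - r - 1, by omega, fun t h1 h2 => hrun t (by omega) h2, hbad, fun θ hall => ?_⟩
        obtain ⟨t, h1, h2, h3⟩ := halive θ
        exact absurd (hall t h1 h2) (not_lt.mpr h3)
  -- events ⊆ (right wall virtual or killing) ∪ (left wall virtual or killing) ∪ (cut–cut events)
  have hsub : P.filter (fun pq => pq.1 < pq.2 ∧ pq.2 ≤ n ∧ Mc pq ∧ Lc pq ∧ Rc pq) ⊆
      (P.filter (fun pq => pq.1 < pq.2 ∧ pq.2 ≤ n ∧ Mc pq ∧ (RV pq ∨ RK pq)) ∪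
        P.filter (fun pq => pq.1 < pq.2 ∧ pq.2 ≤ n ∧ Mc pq ∧ (LV pq ∨ LK pq))) ∪
      P.filter (fun pq => pq.1 < pq.2 ∧ pq.2 ≤ n ∧ Mc pq ∧ Lc pq ∧ Rc pq ∧ RC pq ∧ LC pq) := by
    intro pq hpq
    rw [mem_filter] at hpq
    obtain ⟨hP', hlt, hqn, hM, hLc', hRc'⟩ := hpq
    rw [mem_union, mem_union, mem_filter, mem_filter, mem_filter]
    rcases hRtri pq hRc' with hv | hk | hc
    · exact Or.inl (Or.inl ⟨hP', hlt, hqn, hM, Or.inl hv⟩)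
    · exact Or.inl (Or.inl ⟨hP', hlt, hqn, hM, Or.inr hk⟩)
    · rcases hLtri pq hLc' with hv' | hk' | hc'
      · exact Or.inl (Or.inr ⟨hP', hlt, hqn, hM, Or.inl hv'⟩)
      · exact Or.inl (Or.inr ⟨hP', hlt, hqn, hM, Or.inr hk'⟩)
      · exact Or.inr ⟨hP', hlt, hqn, hM, hLc', hRc', hc, hc'⟩
  refine (card_le_card hsub).trans ((card_union_le _ _).trans ?_)
  have h2 := card_union_le (P.filter (fun pq => pq.1 < pq.2 ∧ pq.2 ≤ n ∧ Mc pq ∧ (RV pq ∨ RK pq)))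
    (P.filter (fun pq => pq.1 < pq.2 ∧ pq.2 ≤ n ∧ Mc pq ∧ (LV pq ∨ LK pq)))
  omega

/-! ## The shape of a cutting wall: parity flip iff the base slope is in between (ORDER.md Lemma 2) -/

/-- **CUT PARITY ⟺ SLOPE BETWEENNESS** (ORDER.md Lemma 2, val-sym-lift-p4 g10).  Base line `o`, a partner `q` (gap zero at the parameter `τ`)
and a wall `c` strictly incorrect at `τ`, both non-parallel to `o`; if at some parameter `q` and `c` are SIMULTANEOUSLY strictly correct against `o`
(the wall CUTS rather than kills), then `c` and `q` have opposite parities iff the slope of `o` lies strictly between those of `q` and `c`.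
(Along `o` both gaps are affine and vanish/turn negative at `τ`, positive at the common parameter: their slopes have the same sign.) [folklore] -/
theorem cut_parity_iff_slope_between {o q c : ℕ} {τ : ℝ} (hAq : a o ≠ a q) (hAc : a o ≠ a c)
    (hq : gap q (L a b o τ) (L a b q τ) = 0) (hc : gap c (L a b o τ) (L a b c τ) < 0)
    (halive : ∃ θ, 0 < gap q (L a b o θ) (L a b q θ) ∧ 0 < gap c (L a b o θ) (L a b c θ)) :
    (Even c ↔ ¬ Even q) ↔ ((a q < a o ∧ a o < a c) ∨ (a c < a o ∧ a o < a q)) := by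
  obtain ⟨θ, hqθ, hcθ⟩ := halive
  have eq1 := gap_along_line a b o q τ
  have eq2 := gap_along_line a b o q θ
  have ec1 := gap_along_line a b o c τ
  have ec2 := gap_along_line a b o c θ
  -- the slopes of the two gaps along `o`
  set sq : ℝ := (if Even q then a q - a o else a o - a q) with hsq
  set sc : ℝ := (if Even c then a c - a o else a o - a c) with hsc
  have h1 : 0 < sq * (θ - τ) := by nlinarith
  have h2 : 0 < sc * (θ - τ) := by nlinarith
  -- hence `sq` and `sc` have the same sign
  have hsame : (0 < sq ↔ 0 < sc) := by
    rcases lt_trichotomy 0 (θ - τ) with hd | hd | hd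
    · constructor
      · intro _; by_contra hh; push Not at hh; nlinarith
      · intro _; by_contra hh; push Not at hh; nlinarith
    · rw [← hd, mul_zero] at h1; exact absurd h1 (lt_irrefl _)
    · constructor
      · intro hh; nlinarith
      · intro hh; nlinarith
  -- unfold the four parity cases
  by_cases heq : Even q <;> by_cases hec : Even c
  · -- both even: same sign means `o` is NOT between
    rw [hsq, if_pos heq] at hsame; rw [hsc, if_pos hec] at hsame
    have hnb : ¬ ((a q < a o ∧ a o < a c) ∨ (a c < a o ∧ a o < a q)) := by
      rintro (⟨h1', h2'⟩ | ⟨h1', h2'⟩)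
      · have := hsame.mpr (by linarith); linarith
      · have := hsame.mp (by linarith); linarith
    exact ⟨fun h => ((h.mp hec) heq).elim, fun hb => (hnb hb).elim⟩
  · -- `q` even, `c` odd: `o` is between
    rw [hsq, if_pos heq] at hsame; rw [hsc, if_neg hec] at hsame
    have lhs : (Even c ↔ ¬ Even q) := ⟨fun h => absurd h hec, fun h => absurd heq h⟩
    refine ⟨fun _ => ?_, fun _ => lhs⟩
    rcases lt_or_gt_of_ne hAq with h | h
    · have := hsame.mp (by linarith); exact Or.inr ⟨by linarith, h⟩
    · rcases lt_or_gt_of_ne hAc with h' | h'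
      · exact Or.inl ⟨h, h'⟩
      · have := hsame.mpr (by linarith); linarith
  · -- `q` odd, `c` even: `o` is between
    rw [hsq, if_neg heq] at hsame; rw [hsc, if_pos hec] at hsame
    have lhs : (Even c ↔ ¬ Even q) := ⟨fun _ => heq, fun _ => hec⟩
    refine ⟨fun _ => ?_, fun _ => lhs⟩
    rcases lt_or_gt_of_ne hAq with h | h
    · rcases lt_or_gt_of_ne hAc with h' | h'
      · have := hsame.mpr (by linarith); linarith
      · exact Or.inr ⟨h', h⟩
    · have := hsame.mp (by linarith); exact Or.inl ⟨h, by linarith⟩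
  · -- both odd: NOT between
    rw [hsq, if_neg heq] at hsame; rw [hsc, if_neg hec] at hsame
    have hnb : ¬ ((a q < a o ∧ a o < a c) ∨ (a c < a o ∧ a o < a q)) := by
      rintro (⟨h1', h2'⟩ | ⟨h1', h2'⟩)
      · have := hsame.mp (by linarith); linarith
      · have := hsame.mpr (by linarith); linarith
    exact ⟨fun h => (hec (h.mpr heq)).elim, fun hb => (hnb hb).elim⟩

end

end StaticPathFold

end Summit.ValiantsHypothesis.ValiantsHypothesis.Theorems.KPlusLogSqLaw
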